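import Mathlib
import Summits.ResolutionOfSingularities.ResolutionOfSingularities.Theorems.WildQuotientsWildQuotientResolutionS1aTameToBR

/-!
# The induced-torus ring `R = ⊕_λ 𝒜(λ mod r)·y^λ` of a `Π ZMod (r j)`-graded algebra: definitions and grading
(crux stmt-ResolutionOfSingularities-17941 `WildQuotients.CyclicQuotientFourfolds`, line B `s1a-tamebr`, stub
`stub_tameToBR` sub-structure (S1) `S1.TameToBR.InducedTorusStatement` of `…S1aTameToBR` (p563790); plan-1
ASSIGN 2026-08-27T19:48:55Z. [OURS · L1 W4.5c] — NOT statements of the manuscript; counted 0.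
Owner res-L1-w45c-stub-4 (gen 5).)

For a commutative `k`-algebra `B` graded by `D^ = Π j : Fin m, ZMod (r j)` via `𝒜`, the INDUCED-TORUS RING is
`R = ⊕_{λ ∈ ℤᵐ} 𝒜(λ̄)`, `λ̄ = λ mod r` (the ring of functions on `Spec B ×^{D} 𝔾ₘᵐ`, i.e. `⊕_λ 𝒜(λ̄)·y^λ ⊂
B[y₁^{±1},…,y_m^{±1}]`), realised as the external direct sum of the pulled-back family with the multiplication
of `B` (`SetLike.gcommRing`), and graded TAUTOLOGICALLY by `ℤᵐ`:
* `InducedTorus.torusDeg r : (Fin m → ℤ) →+ Π j, ZMod (r j)` — reduction `λ ↦ λ̄`;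
* `InducedTorus.pull r 𝒜 λ := 𝒜 (torusDeg r λ)` and its `SetLike.GradedMonoid` structure;
* `InducedTorus.InducedRing r 𝒜 := ⨁ λ, ↥(pull r 𝒜 λ)` (a commutative `k`-algebra);
* `InducedTorus.grade r 𝒜 λ := range (lof λ)`, `SetLike.GradedMonoid`, and the `GradedAlgebra` structure
  (`InducedTorus.decomposeAux`, `InducedTorus.gradedAlgebra`).
Instances are declared only on the NEW type `InducedRing` / the new families (no instance on a pre-existing type).
-/

set_option linter.dupNamespace false

noncomputable section

open DirectSum

namespace Summit.ResolutionOfSingularities.ResolutionOfSingularities.Theorems.WildQuotientResolution.S1.InducedTorus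

variable {m : ℕ} (r : Fin m → ℕ)

/-- **Reduction of torus characters**: `λ ↦ (λ j mod r j)_j`. [OURS · L1 W4.5c] -/
def torusDeg : (Fin m → ℤ) →+ (Π j : Fin m, ZMod (r j)) where
  toFun l := fun j => ((l j : ℤ) : ZMod (r j))
  map_zero' := funext fun j => by simp
  map_add' a b := funext fun j => by simp

/-- `torusDeg r λ j = λ j` in `ZMod (r j)`. [OURS · L1 W4.5c] -/
@[simp] theorem torusDeg_apply (l : Fin m → ℤ) (j : Fin m) : torusDeg r l j = ((l j : ℤ) : ZMod (r j)) := rfl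

/-- `torusDeg` is surjective (every residue vector lifts). [OURS · L1 W4.5c] -/
theorem torusDeg_surjective : Function.Surjective (torusDeg r) := fun d =>
  ⟨fun j => ((d j).cast : ℤ), funext fun j => by rw [torusDeg_apply, ZMod.intCast_zmod_cast]⟩

variable {k : Type} [Field k] {B : Type} [CommRing B] [Algebra k B]
variable (𝒜 : (Π j : Fin m, ZMod (r j)) → Submodule k B)

/-- **The pulled-back family** `λ ↦ 𝒜(λ mod r)`. [OURS · L1 W4.5c] -/
def pull (l : Fin m → ℤ) : Submodule k B := 𝒜 (torusDeg r l)

/-- Membership in the pulled-back family. [OURS · L1 W4.5c] -/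
theorem mem_pull_iff (l : Fin m → ℤ) (b : B) : b ∈ pull r 𝒜 l ↔ b ∈ 𝒜 (torusDeg r l) := Iff.rfl

/-- The pulled-back family is a graded monoid (inside `B`). [OURS · L1 W4.5c] -/
instance pull.gradedMonoid [SetLike.GradedMonoid 𝒜] : SetLike.GradedMonoid (pull r 𝒜) where
  one_mem := by
    rw [mem_pull_iff, map_zero]
    exact SetLike.one_mem_graded 𝒜
  mul_mem := fun i j _ _ ha hb => by
    rw [mem_pull_iff, map_add]
    exact SetLike.mul_mem_graded ha hb

/-- **The induced-torus ring** `R = ⊕_{λ ∈ ℤᵐ} 𝒜(λ mod r)` (external direct sum, multiplication from `B`).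
[OURS · L1 W4.5c] -/
abbrev InducedRing : Type := ⨁ l : Fin m → ℤ, ↥(pull r 𝒜 l)

/-- **The tautological `ℤᵐ`-grading** of the induced-torus ring: the `λ`-th piece is the range of the `λ`-th
inclusion. [OURS · L1 W4.5c] -/
def grade (l : Fin m → ℤ) : Submodule k (InducedRing r 𝒜) :=
  LinearMap.range (DirectSum.lof k (Fin m → ℤ) (fun μ => ↥(pull r 𝒜 μ)) l)

/-- Membership in a piece of the tautological grading. [OURS · L1 W4.5c] -/
theorem mem_grade_iff (l : Fin m → ℤ) (x : InducedRing r 𝒜) :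
    x ∈ grade r 𝒜 l ↔ ∃ a : ↥(pull r 𝒜 l), DirectSum.of (fun μ => ↥(pull r 𝒜 μ)) l a = x :=
  LinearMap.mem_range

/-- `of λ a` lies in the `λ`-th piece. [OURS · L1 W4.5c] -/
theorem of_mem_grade (l : Fin m → ℤ) (a : ↥(pull r 𝒜 l)) :
    DirectSum.of (fun μ => ↥(pull r 𝒜 μ)) l a ∈ grade r 𝒜 l :=
  (mem_grade_iff r 𝒜 l _).mpr ⟨a, rfl⟩

/-- The `λ`-th inclusion, with values in the `λ`-th piece. [OURS · L1 W4.5c] -/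
def toGrade (l : Fin m → ℤ) : ↥(pull r 𝒜 l) →+ ↥(grade r 𝒜 l) where
  toFun a := ⟨DirectSum.of (fun μ => ↥(pull r 𝒜 μ)) l a, of_mem_grade r 𝒜 l a⟩
  map_zero' := Subtype.ext (map_zero _)
  map_add' a b := Subtype.ext (map_add _ a b)

/-- The value of `toGrade`. [OURS · L1 W4.5c] -/
@[simp] theorem coe_toGrade (l : Fin m → ℤ) (a : ↥(pull r 𝒜 l)) :
    ((toGrade r 𝒜 l a : ↥(grade r 𝒜 l)) : InducedRing r 𝒜) = DirectSum.of (fun μ => ↥(pull r 𝒜 μ)) l a :=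
  rfl

/-- The decomposition map of the tautological grading. [OURS · L1 W4.5c] -/
def decomposeAux : InducedRing r 𝒜 →+ ⨁ l : Fin m → ℤ, ↥(grade r 𝒜 l) :=
  DirectSum.toAddMonoid fun l => (DirectSum.of (fun μ => ↥(grade r 𝒜 μ)) l).comp (toGrade r 𝒜 l)

/-- `decomposeAux (of λ a) = of λ ⟨of λ a, _⟩`. [OURS · L1 W4.5c] -/
theorem decomposeAux_of (l : Fin m → ℤ) (a : ↥(pull r 𝒜 l)) :
    decomposeAux r 𝒜 (DirectSum.of (fun μ => ↥(pull r 𝒜 μ)) l a) =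
      DirectSum.of (fun μ => ↥(grade r 𝒜 μ)) l (toGrade r 𝒜 l a) := by
  rw [decomposeAux, DirectSum.toAddMonoid_of, AddMonoidHom.comp_apply]

/-- The decomposition map is a left inverse of the summation map. [OURS · L1 W4.5c] -/
theorem coe_comp_decomposeAux :
    (DirectSum.coeAddMonoidHom (grade r 𝒜)).comp (decomposeAux r 𝒜) = AddMonoidHom.id _ := by
  refine DirectSum.addHom_ext fun l a => ?_
  rw [AddMonoidHom.comp_apply, decomposeAux_of, DirectSum.coeAddMonoidHom_of, AddMonoidHom.id_apply, coe_toGrade]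

/-- The decomposition map is a right inverse of the summation map. [OURS · L1 W4.5c] -/
theorem decomposeAux_comp_coe :
    (decomposeAux r 𝒜).comp (DirectSum.coeAddMonoidHom (grade r 𝒜)) = AddMonoidHom.id _ := by
  refine DirectSum.addHom_ext fun l x => ?_
  obtain ⟨a, ha⟩ := (mem_grade_iff r 𝒜 l _).mp x.2
  rw [AddMonoidHom.comp_apply, DirectSum.coeAddMonoidHom_of, AddMonoidHom.id_apply, ← ha, decomposeAux_of]
  congr 1
  exact Subtype.ext ha

section Graded

variable [SetLike.GradedMonoid 𝒜]

/-- The tautological grading is a graded monoid. [OURS · L1 W4.5c] -/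
instance grade.gradedMonoid : SetLike.GradedMonoid (grade r 𝒜) where
  one_mem := (mem_grade_iff r 𝒜 0 1).mpr
    ⟨@GradedMonoid.GOne.one _ (fun μ => ↥(pull r 𝒜 μ)) _ _, (DirectSum.one_def fun μ => ↥(pull r 𝒜 μ)).symm⟩
  mul_mem := by
    rintro i j _ _ hx hy
    obtain ⟨a, rfl⟩ := (mem_grade_iff r 𝒜 i _).mp hx
    obtain ⟨b, rfl⟩ := (mem_grade_iff r 𝒜 j _).mp hy
    exact (mem_grade_iff r 𝒜 (i + j) _).mpr
      ⟨@GradedMonoid.GMul.mul _ (fun μ => ↥(pull r 𝒜 μ)) _ _ i j a b,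
        (DirectSum.of_mul_of (A := fun μ => ↥(pull r 𝒜 μ)) a b).symm⟩

/-- **The induced-torus ring is a `ℤᵐ`-graded `k`-algebra** (tautological grading). [OURS · L1 W4.5c] -/
instance gradedAlgebra : GradedAlgebra (grade r 𝒜) where
  decompose' := decomposeAux r 𝒜
  left_inv := DFunLike.congr_fun (coe_comp_decomposeAux r 𝒜)
  right_inv := DFunLike.congr_fun (decomposeAux_comp_coe r 𝒜)

/-- The decomposition of `of λ a`. [OURS · L1 W4.5c] -/
theorem decompose_of (l : Fin m → ℤ) (a : ↥(pull r 𝒜 l)) :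
    DirectSum.decompose (grade r 𝒜) (DirectSum.of (fun μ => ↥(pull r 𝒜 μ)) l a) =
      DirectSum.of (fun μ => ↥(grade r 𝒜 μ)) l (toGrade r 𝒜 l a) :=
  decomposeAux_of r 𝒜 l a

end Graded

end Summit.ResolutionOfSingularities.ResolutionOfSingularities.Theorems.WildQuotientResolution.S1.InducedTorus

end
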